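import Summits.QuantumFields.BalabanUV.Beta.GAN24.FineReadoutCauchyAmp
import Summits.QuantumFields.BalabanUV.Beta.GAN24.FibreRateFeed

/-!
# `BalabanUV.Beta.GAN24.FineReadoutCauchyMatched` — binder row G-an2-4 / (CONV-C), S-slot located remainder «E3SupRate», located leaf «(N1-Cauchy)»
# (owner spec `HOME/b2b-balaban-gan24-p1/N1-CAUCHY-SPEC.md`; holder leaf-17's division + HOLDER RULING 2026-08-20T05:15Z «PART A as typed by
# leaf-16-g9 ACCEPTED VERBATIM: real momentum, T00's concrete `Ahat`, matched label `AliasReindex.lift`»), PART A «matched sub-alias», part 3/3a: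
# THE NORMALISED T00 MINIMISER AMPLITUDE IS THE MODEL AMPLITUDE; ITS N-UNIFORM BOUND AND ITS MATCHED-LABEL TWO-LEVEL RATE WITH THE TREE's
# CAPACITANCE DATA (leaf-20's `CapacitanceRateScaled` / `CapacitanceRateDictionary` BY NAME)

NOT IN PRINT; OUR PROOF ATTEMPT (of the road; THIS file is [folklore] bookkeeping: an algebraic IDENTIFICATION over typer row T00
`GAN24/AliasObjects` at real momentum (leaf-14's `FibreRateTBlock` dictionary `dAl_ofRealVec`/`dbAl_ofRealVec`/`LAl_ofRealVec_eq`, `AliasReindex`'s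
`kSym` forms, leaf-20's `FibreRateMM.phiSol_zero_eVec`/`FibreRateFeed.cSol_zero_eVec`) plus the plug of leaf-20's capacitance sizes/rates into part 2's
abstract bound/rate; no cited fact, no wall binder, no `def … : Prop`).  HONEST FRAMING (cell contract, verbatim): «discharging `BetaPertH` makes
Bałaban's UV stability UNCONDITIONAL — a real constructive-QFT result; it is NOT the continuum limit and NOT the Clay problem.»  HONEST DEPENDENCY
(verbatim): «continuum YM on T⁴ ⇐ BetaPertH ∧ nine spine estimates (0/9 proved); BetaPertH ⇐ (D1) ∧ (D4) ∧ CAP+tail; G-an2-4 gates asym, D1 and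
NE2/3/4.»  Discharges NOTHING of (hS, hSall) / «E3SupRate» / «(N1-Cauchy)» (PART A is one of six parts F, N, A, C, K, S of ONE located leaf of the
five DIFF rows); NOT `BetaPertH`, NOT continuum, NOT Clay.

## What is proved (generic `D`; `1 ≤ N ≤ N′`; REAL momentum `p = ofRealVec pr`, `|pr_i| ≤ π`, `pr ≠ 0`; label `m : TorusSite D N`, `P = qlab pr m`)
* §1 label facts: `abs_le_abs_qlab` (`|pr_i| ≤ |P_i|`), `qlab_ne_zero`, `momSq_le_momSq_qlab`, `qlab_zone_one` (`|P_i| ≤ 5πN/3`, every `N ≥ 1` — leaf-11's `FibreRateTBlockLabel.qlab_zone` is the `N ≥ 2` case),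
  `qlab_lift` (`qlab pr (lift N′ m) = qlab pr m`).
* §2 the scaled capacitance data of the constraint source `e_l`: `phiT N pr l κ′ := N^{D+4}·(cap N p)⁻¹ (inl κ′) (inl l)`,
  `cT N pr l := N^{D+4}·(cap N p)⁻¹ (inr ()) (inl l)` with leaf-20's sizes `‖phiT‖ ≤ cPP·|q|²`, `‖cT‖ ≤ cPc·|q|²√|q|²` and rates
  `‖phiT N′ − phiT N‖ ≤ crPP·|q|⁴/N²`, `‖cT N′ − cT N‖ ≤ crPc·|q|⁴√|q|²/N²` BY NAME.
* §3 **`ampT_eq_ampModel`** — THE IDENTIFICATION: `ampT N pr l m κ := N^{D+1}·Ahat N (ofRealVec pr) 0 (eVec l) m κ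
  = ampModel N (qlab pr m) pr (phiT N pr l) (cT N pr l) κ` (part 2's model), via the abstract homogeneity identity `Asol_scaled_eq` and the
  telescoping `dbAl_l·sbAl_l = E_l(pr)` (leaf-02's `CapacitanceClosedFormAlias.dbAl_mul_sbAl`); and `ampT_lift_eq_ampModel`: at `(N′, lift N′ m)` the SAME label appears.
* §4 **(A-bound) `norm_ampT_le`**: `‖ampT N pr l m κ‖ ≤ WS P · inB ρ (qn pr) (cPP·s²) (cPc·s³)` and
  **(A-rate) `norm_ampT_lift_sub_le`**: `‖ampT N′ pr l (lift N′ m) κ − ampT N pr l m κ‖ ≤ (6/N)·Σmax·WS·inB + WS·inR(…)` with `s² = momSq pr`,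
  `ρ² = momSq P`, every `1 ≤ N ≤ N′`, `m` ARBITRARY (`m = 0` included — no ∃c, no scaled pair).
Part 3b (`GAN24/FineReadoutCauchyMatchedSum`) collapses the displayed constants to `K·(1+ρ)/N·WS·s²/ρ²`, translates to leaf-16's
`AliasPointSum.pointWeight` currency, adds the Lc-cell factor (A-cell) and the N-uniform alias sum for the holder's PART S.
Unit `b2b-balaban-gan24-formalise-leaf-16` (G-an2-4 formalisation swarm, leaf prover 16, gen 9), 2026-08-20.
-/

noncomputable section

open Complex Finset
open scoped BigOperators Real

namespace Summit.QuantumFields.BalabanUV.Beta.GAN24.FineReadoutCauchyMatched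

open Literature.Probability.LatticeModels (TorusSite)
open Literature.MathematicalPhysics.QuantumFieldTheory.Balaban1983to89.B4Strip (ofRealVec)
open Literature.MathematicalPhysics.QuantumFieldTheory.King1986 (latticeSymbol momSq momSq_nonneg)
open Summit.QuantumFields.BalabanUV.Beta.GAN24.FibreBlockSolve (dot Asol)
open Summit.QuantumFields.BalabanUV.Beta.GAN24.AliasObjects (gs sbAl chiAl dAl dbAl LAl cap Ahat gAl phiSol cSol eVec)
open Summit.QuantumFields.BalabanUV.Beta.GAN24.AliasReindex (srep lift srep_lift natAbs_srep_le sbAl_eq_kSym chiAl_eq_kSym)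
open Summit.QuantumFields.BalabanUV.Beta.GAN24.FibreRateTBlock (qlab kSym_ofRealVec_apply dAl_ofRealVec dbAl_ofRealVec LAl_ofRealVec_eq)
open Summit.QuantumFields.BalabanUV.Beta.GAN24.FibreRateTBlockRate (label_zone ell_pos)
open Summit.QuantumFields.BalabanUV.Beta.GAN24.CapacitanceEndpointBlocks (cPP cPc)
open Summit.QuantumFields.BalabanUV.Beta.GAN24.CapacitanceEndpoint (norm_cap_inv_inl_inl_le norm_cap_inv_inr_inl_le)
open Summit.QuantumFields.BalabanUV.Beta.GAN24.CapacitanceRateScaled (crPP crPc scaled_cap_inv_inl_inl_rate scaled_cap_inv_inr_inl_rate)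
open Summit.QuantumFields.BalabanUV.Beta.GAN24.FibreRateMM (phiSol_zero_eVec)
open Summit.QuantumFields.BalabanUV.Beta.GAN24.FibreRateFeed (cSol_zero_eVec)
open Summit.QuantumFields.BalabanUV.Beta.GAN24.CapacitanceScalarBounds (momSq_pos)
open Summit.QuantumFields.BalabanUV.Beta.GAN24.FineReadoutCauchyScalars
open Summit.QuantumFields.BalabanUV.Beta.GAN24.FineReadoutCauchyAmp

variable {D : ℕ}

/-! ## §1 Label facts: the symmetric label `P = qlab pr m = pr + 2π·srep m` -/

section Label

variable {N N' : ℕ}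

/-- [folklore] **Every coordinate of the label dominates the coarse momentum**: `|pr_i| ≤ |pr_i + 2π·srep m i|` for `|pr_i| ≤ π`
(either `srep m i = 0`, or `|2π·srep| ≥ 2π ≥ 2|pr_i|`). -/
theorem abs_le_abs_qlab {pr : Fin D → ℝ} (hq : ∀ i, |pr i| ≤ π) (m : TorusSite D N) (i : Fin D) : |pr i| ≤ |qlab pr m i| := by
  unfold qlab
  rcases eq_or_ne (srep m i) 0 with h0 | h0
  · rw [h0]; simp
  · have h1 : (1 : ℝ) ≤ |((srep m i : ℤ) : ℝ)| := by
      rw [← Int.cast_abs]; exact_mod_cast Int.one_le_abs h0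
    have hπ := Real.pi_pos
    have h2 : 2 * π ≤ |2 * π * ((srep m i : ℤ) : ℝ)| := by
      rw [abs_mul, abs_of_pos (by positivity : (0:ℝ) < 2 * π)]; nlinarith
    have h3 : |2 * π * ((srep m i : ℤ) : ℝ)| - |pr i| ≤ |pr i + 2 * π * ((srep m i : ℤ) : ℝ)| := by
      have := abs_sub_abs_le_abs_sub (2 * π * ((srep m i : ℤ) : ℝ)) (-(pr i))
      rw [abs_neg, sub_neg_eq_add, add_comm] at this
      exact this
    linarith [hq i]

/-- [folklore] `momSq pr ≤ momSq (qlab pr m)`. -/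
theorem momSq_le_momSq_qlab {pr : Fin D → ℝ} (hq : ∀ i, |pr i| ≤ π) (m : TorusSite D N) : momSq pr ≤ momSq (qlab pr m) := by
  unfold momSq
  exact Finset.sum_le_sum fun i _ => by
    rw [← sq_abs (pr i), ← sq_abs (qlab pr m i)]
    exact pow_le_pow_left₀ (abs_nonneg _) (abs_le_abs_qlab hq m i) 2

/-- [folklore] `pr ≠ 0 ⇒ qlab pr m ≠ 0` (on `|pr_i| ≤ π`). -/
theorem qlab_ne_zero {pr : Fin D → ℝ} (hq : ∀ i, |pr i| ≤ π) (hq0 : pr ≠ 0) (m : TorusSite D N) : qlab pr m ≠ 0 := by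
  intro h
  have hpos := momSq_pos hq0
  have hle := momSq_le_momSq_qlab hq m
  rw [h] at hle
  have : momSq (0 : Fin D → ℝ) = 0 := by simp [momSq]
  linarith

/-- [folklore] **The label lies in King's extended zone** `|P_i| ≤ 5πN/3` for EVERY `N ≥ 1` (`N ≥ 2`: leaf-14's `label_zone`; `N = 1`: `srep = 0`). -/
theorem qlab_zone_one [NeZero N] (hN : 1 ≤ N) {pr : Fin D → ℝ} (hq : ∀ i, |pr i| ≤ π) (m : TorusSite D N) (i : Fin D) :
    |qlab pr m i| ≤ 5 * π / 3 * (N : ℝ) := by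
  rcases lt_or_eq_of_le hN with h2 | h1
  · exact label_zone (by omega) (hq i) (natAbs_srep_le m i)
  · have hs : srep m i = 0 := by
      have h := natAbs_srep_le m i
      have h0 : N / 2 = 0 := by omega
      rw [h0] at h
      exact Int.natAbs_eq_zero.1 (Nat.le_zero.1 h)
    unfold qlab
    rw [hs]
    simp only [Int.cast_zero, mul_zero, add_zero]
    have hπ := Real.pi_pos
    calc |pr i| ≤ π := hq i
      _ ≤ 5 * π / 3 * (N : ℝ) := by rw [← h1]; norm_num; linarith

/-- [folklore] **THE LIFTED LABEL IS THE SAME LABEL**: `qlab pr (lift N′ m) = qlab pr m` (`N ≤ N′`; `AliasReindex.srep_lift`). -/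
theorem qlab_lift [NeZero N] [NeZero N'] (hNN' : N ≤ N') (pr : Fin D → ℝ) (m : TorusSite D N) : qlab pr (lift N' m) = qlab pr m := by
  funext i
  unfold qlab
  rw [srep_lift hNN']

end Label

/-! ## §2 The scaled capacitance data of the constraint source (leaf-20's L08/L11 blocks BY NAME) -/

section Cap

variable {N N' : ℕ} [NeZero N] [NeZero N']

/-- [folklore] THE SCALED MULTIPLIER RESPONSE `φ̃_{κ′} := N^{D+4}·(cap N p)⁻¹ (inl κ′) (inl l)` (`= N^{D+4}·phiSol N p 0 (eVec l) κ′`). -/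
def phiT (N : ℕ) [NeZero N] (pr : Fin D → ℝ) (l : Fin D) : Fin D → ℂ :=
  fun κ' => (N : ℂ) ^ (D + 4) * (cap N (ofRealVec pr))⁻¹ (Sum.inl κ') (Sum.inl l)

/-- [folklore] THE SCALED GAUGE CONSTANT `c̃ := N^{D+4}·(cap N p)⁻¹ (inr ()) (inl l)` (`= N^{D+4}·cSol N p 0 (eVec l)`). -/
def cT (N : ℕ) [NeZero N] (pr : Fin D → ℝ) (l : Fin D) : ℂ :=
  (N : ℂ) ^ (D + 4) * (cap N (ofRealVec pr))⁻¹ (Sum.inr ()) (Sum.inl l)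

/-- [folklore] `‖φ̃_{κ′}‖ ≤ cPP·|q|²` (`CapacitanceEndpoint.norm_cap_inv_inl_inl_le` BY NAME). -/
theorem norm_phiT_le (hN : 1 ≤ N) {pr : Fin D → ℝ} (hq : ∀ i, |pr i| ≤ π) (hq0 : pr ≠ 0) (l κ' : Fin D) :
    ‖phiT N pr l κ'‖ ≤ cPP D * momSq pr := by
  have hN0 : (0 : ℝ) < N := by exact_mod_cast hN
  have hM : (0 : ℝ) < (N : ℝ) ^ (D + 4) := by positivity
  unfold phiT
  rw [norm_mul, norm_pow, Complex.norm_natCast]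
  calc (N : ℝ) ^ (D + 4) * ‖(cap N (ofRealVec pr))⁻¹ (Sum.inl κ') (Sum.inl l)‖
      ≤ (N : ℝ) ^ (D + 4) * (cPP D * momSq pr / (N : ℝ) ^ (D + 4)) :=
        mul_le_mul_of_nonneg_left (norm_cap_inv_inl_inl_le hN hq hq0 κ' l) hM.le
    _ = cPP D * momSq pr := by field_simp

/-- [folklore] `‖c̃‖ ≤ cPc·|q|²√|q|²` (`CapacitanceEndpoint.norm_cap_inv_inr_inl_le` BY NAME). -/
theorem norm_cT_le (hN : 1 ≤ N) {pr : Fin D → ℝ} (hq : ∀ i, |pr i| ≤ π) (hq0 : pr ≠ 0) (l : Fin D) :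
    ‖cT N pr l‖ ≤ cPc D * (momSq pr * Real.sqrt (momSq pr)) := by
  have hN0 : (0 : ℝ) < N := by exact_mod_cast hN
  have hM : (0 : ℝ) < (N : ℝ) ^ (D + 4) := by positivity
  unfold cT
  rw [norm_mul, norm_pow, Complex.norm_natCast]
  calc (N : ℝ) ^ (D + 4) * ‖(cap N (ofRealVec pr))⁻¹ (Sum.inr ()) (Sum.inl l)‖
      ≤ (N : ℝ) ^ (D + 4) * (cPc D * (momSq pr * Real.sqrt (momSq pr)) / (N : ℝ) ^ (D + 4)) :=
        mul_le_mul_of_nonneg_left (norm_cap_inv_inr_inl_le hN hq hq0 () l) hM.le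
    _ = cPc D * (momSq pr * Real.sqrt (momSq pr)) := by field_simp

/-- [folklore] **THE TWO-LEVEL RATE of `φ̃`**: `‖φ̃_{N′} − φ̃_N‖ ≤ crPP·|q|⁴/N²` (`CapacitanceRateScaled.scaled_cap_inv_inl_inl_rate` BY NAME). -/
theorem norm_phiT_sub_le (hN : 1 ≤ N) (hNN' : N ≤ N') {pr : Fin D → ℝ} (hq : ∀ i, |pr i| ≤ π) (hq0 : pr ≠ 0) (l κ' : Fin D) :
    ‖phiT N' pr l κ' - phiT N pr l κ'‖ ≤ crPP D * momSq pr ^ 2 / (N : ℝ) ^ 2 :=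
  scaled_cap_inv_inl_inl_rate hN hNN' hq hq0 κ' l

/-- [folklore] **THE TWO-LEVEL RATE of `c̃`**: `‖c̃_{N′} − c̃_N‖ ≤ crPc·|q|⁴√|q|²/N²` (`CapacitanceRateScaled.scaled_cap_inv_inr_inl_rate` BY NAME). -/
theorem norm_cT_sub_le (hN : 1 ≤ N) (hNN' : N ≤ N') {pr : Fin D → ℝ} (hq : ∀ i, |pr i| ≤ π) (hq0 : pr ≠ 0) (l : Fin D) :
    ‖cT N' pr l - cT N pr l‖ ≤ crPc D * (momSq pr ^ 2 * Real.sqrt (momSq pr)) / (N : ℝ) ^ 2 :=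
  scaled_cap_inv_inr_inl_rate hN hNN' hq hq0 () l

end Cap

/-! ## §3 The identification `N^{D+1}·Ahat = ampModel` -/

/-- [folklore] THE ABSTRACT HOMOGENEITY IDENTITY behind the identification: with `dd_κ = a/N`, `L = ℓ/N²`, `g_{l′} = χ·(N·γ_{l′})·(φ̃_{l′}/N^{D+4})`,
`Σ_{l′} db_{l′}·g_{l′} = χ·S/N^{D+4}` and `cc = χ·c̃/N^{D+4}`:
`N^{D+1}·Asol dd db g L cc κ = χ·((ℓ⁻¹/2)·γ_κ·φ̃_κ − (ℓ⁻²/2)·a·S + ℓ⁻²·a·c̃)`. -/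
theorem Asol_scaled_eq {Nc ℓ a χ γκ φκ S cc ct : ℂ} (hN : Nc ≠ 0) (hℓ : ℓ ≠ 0) {dd db g : Fin D → ℂ} {L : ℂ} (κ : Fin D)
    (hdd : dd κ = a / Nc) (hL : L = ℓ / Nc ^ 2) (hg : g κ = χ * (Nc * γκ) * (φκ / Nc ^ (D + 4)))
    (hdot : dot db g = χ * S / Nc ^ (D + 4)) (hcc : cc = χ * ct / Nc ^ (D + 4)) :
    Nc ^ (D + 1) * Asol dd db g L cc κ = χ * ((ℓ⁻¹ / 2) * γκ * φκ - (ℓ⁻¹ ^ 2 / 2) * a * S + ℓ⁻¹ ^ 2 * a * ct) := by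
  unfold Asol
  rw [hdd, hL, hg, hdot, hcc]
  have hN4 : Nc ^ (D + 4) = Nc ^ (D + 1) * Nc ^ 3 := by rw [← pow_add]
  rw [hN4]
  field_simp

section Ident

variable {N N' : ℕ} [NeZero N] [NeZero N']

/-- [folklore] THE NORMALISED T00 MINIMISER AMPLITUDE `Ã_N(m)_κ := N^{D+1}·Ahat N (ofRealVec pr) 0 (eVec l) m κ`. -/
def ampT (N : ℕ) [NeZero N] (pr : Fin D → ℝ) (l : Fin D) (m : TorusSite D N) (κ : Fin D) : ℂ :=
  (N : ℂ) ^ (D + 1) * Ahat N (ofRealVec pr) 0 (eVec l) m κ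

/-- [folklore] Dictionary: `N·dAl_κ = a_N(P_κ)` at real momentum. -/
theorem natCast_mul_dAl (pr : Fin D → ℝ) (m : TorusSite D N) (κ : Fin D) :
    (N : ℂ) * dAl N (ofRealVec pr) m κ = aS N (qlab pr m κ) := by
  rw [dAl_ofRealVec]; rfl

/-- [folklore] Dictionary: `dAl_κ = a_N(P_κ)/N`. -/
theorem dAl_eq_aS_div (pr : Fin D → ℝ) (m : TorusSite D N) (κ : Fin D) :
    dAl N (ofRealVec pr) m κ = aS N (qlab pr m κ) / (N : ℂ) := by
  rw [← natCast_mul_dAl, mul_div_cancel_left₀ _ (Nat.cast_ne_zero.2 (NeZero.ne N))]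

/-- [folklore] Dictionary: `N·dbAl_l = a_N(−P_l)`. -/
theorem natCast_mul_dbAl (pr : Fin D → ℝ) (m : TorusSite D N) (l : Fin D) :
    (N : ℂ) * dbAl N (ofRealVec pr) m l = aS N (-qlab pr m l) := by
  rw [dbAl_ofRealVec]
  unfold aS
  congr 3
  push_cast
  ring

/-- [folklore] Dictionary: `sbAl_l = N·γ_N(P_l)`. -/
theorem sbAl_eq_mul_gamS (pr : Fin D → ℝ) (m : TorusSite D N) (l : Fin D) :
    sbAl N (ofRealVec pr) m l = (N : ℂ) * gamS N (qlab pr m l) := by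
  rw [sbAl_eq_kSym, kSym_ofRealVec_apply]
  unfold gamS
  rw [mul_div_cancel₀ _ (Nat.cast_ne_zero.2 (NeZero.ne N))]

/-- [folklore] Dictionary: `chiAl = χ_N(P)`. -/
theorem chiAl_eq_chiS (pr : Fin D → ℝ) (m : TorusSite D N) : chiAl N (ofRealVec pr) m = chiS N (qlab pr m) := by
  rw [chiAl_eq_kSym]
  unfold chiS gamS
  rw [Finset.prod_div_distrib, Finset.prod_const, Finset.card_univ, Fintype.card_fin]
  congr 1
  exact Finset.prod_congr rfl fun i _ => by rw [kSym_ofRealVec_apply]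

/-- [folklore] **THE TELESCOPING AT THE LABEL**: `dbAl_l·sbAl_l = E_l(pr) = e^{−i pr_l} − 1` — level-free AND label-free
(leaf-02's `CapacitanceClosedFormAlias.dbAl_mul_sbAl` `= dflat p l` BY NAME, read at real momentum). -/
theorem dbAl_mul_sbAl_eq_ES (pr : Fin D → ℝ) (m : TorusSite D N) (l : Fin D) :
    dbAl N (ofRealVec pr) m l * sbAl N (ofRealVec pr) m l = ES pr l := by
  rw [CapacitanceClosedFormAlias.dbAl_mul_sbAl N (ofRealVec pr) m l]
  rfl

/-- [folklore] Dictionary: `LAl = ℓ_N(P)/N²`, so `LAl = (uS N P)⁻¹/N²` with part 2's `uS`. -/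
theorem LAl_eq_uS (pr : Fin D → ℝ) (m : TorusSite D N) :
    LAl N (ofRealVec pr) m = ((uS N (qlab pr m))⁻¹ : ℝ) / (N : ℂ) ^ 2 := by
  rw [LAl_ofRealVec_eq]
  unfold uS
  rw [inv_inv]
  push_cast
  ring

/-- [folklore] **THE IDENTIFICATION**: `N^{D+1}·Ahat N (ofRealVec pr) 0 (eVec l) m κ = ampModel N (qlab pr m) pr (φ̃_N) (c̃_N) κ`
for EVERY alias class `m` (the zero alias included), every `N ≥ 1`, every real `pr` with `|pr_i| ≤ π`, `pr ≠ 0`. -/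
theorem ampT_eq_ampModel (hN : 1 ≤ N) {pr : Fin D → ℝ} (hq : ∀ i, |pr i| ≤ π) (hq0 : pr ≠ 0) (l : Fin D) (m : TorusSite D N) (κ : Fin D) :
    ampT N pr l m κ = ampModel N (qlab pr m) pr (phiT N pr l) (cT N pr l) κ := by
  have hNc : (N : ℂ) ≠ 0 := Nat.cast_ne_zero.2 (NeZero.ne N)
  have hN0 : (0 : ℝ) < N := by exact_mod_cast hN
  have hzone : ∀ i, |qlab pr m i| ≤ 5 * π / 3 * (N : ℝ) := qlab_zone_one hN hq m
  have hP0 : qlab pr m ≠ 0 := qlab_ne_zero hq hq0 m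
  have hℓ : (((uS N (qlab pr m))⁻¹ : ℝ) : ℂ) ≠ 0 := by
    rw [Complex.ofReal_ne_zero]; unfold uS; rw [inv_inv]; exact (ell_pos hN0 hzone hP0).ne'
  -- the feed and the sources of T00 with `f̂ = 0`, `ĉ = e_l`
  have hφ : ∀ κ', phiSol N (ofRealVec pr) 0 (eVec l) κ' = phiT N pr l κ' / (N : ℂ) ^ (D + 4) := fun κ' => by
    unfold phiT; rw [phiSol_zero_eVec, mul_div_cancel_left₀ _ (pow_ne_zero _ hNc)]
  have hc : cSol N (ofRealVec pr) 0 (eVec l) = cT N pr l / (N : ℂ) ^ (D + 4) := by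
    unfold cT; rw [cSol_zero_eVec, mul_div_cancel_left₀ _ (pow_ne_zero _ hNc)]
  have hcc : chiAl N (ofRealVec pr) m * cSol N (ofRealVec pr) 0 (eVec l) = chiS N (qlab pr m) * cT N pr l / (N : ℂ) ^ (D + 4) := by
    rw [chiAl_eq_chiS, hc]; field_simp
  have hg : ∀ κ', gAl N (ofRealVec pr) 0 (eVec l) m κ'
      = chiS N (qlab pr m) * ((N : ℂ) * gamS N (qlab pr m κ')) * (phiT N pr l κ' / (N : ℂ) ^ (D + 4)) := fun κ' => by
    unfold AliasObjects.gAl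
    rw [Pi.zero_apply, Pi.zero_apply, zero_add, chiAl_eq_chiS, sbAl_eq_mul_gamS, hφ]
  have hdot : dot (dbAl N (ofRealVec pr) m) (gAl N (ofRealVec pr) 0 (eVec l) m)
      = chiS N (qlab pr m) * (∑ l', ES pr l' * phiT N pr l l') / (N : ℂ) ^ (D + 4) := by
    unfold FibreBlockSolve.dot
    have e : ∀ l', dbAl N (ofRealVec pr) m l' * gAl N (ofRealVec pr) 0 (eVec l) m l'
        = chiS N (qlab pr m) * (ES pr l' * phiT N pr l l') / (N : ℂ) ^ (D + 4) := fun l' => by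
      unfold AliasObjects.gAl
      rw [Pi.zero_apply, Pi.zero_apply, zero_add, chiAl_eq_chiS, hφ, ← dbAl_mul_sbAl_eq_ES pr m l']
      field_simp
    simp_rw [e]
    rw [Finset.mul_sum, Finset.sum_div]
  unfold ampT AliasObjects.Ahat ampModel ampIn
  rw [Asol_scaled_eq (D := D) (χ := chiS N (qlab pr m)) (a := aS N (qlab pr m κ)) (γκ := gamS N (qlab pr m κ))
    (φκ := phiT N pr l κ) (S := ∑ l', ES pr l' * phiT N pr l l') (ct := cT N pr l) hNc hℓ κ (dAl_eq_aS_div pr m κ)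
    (LAl_eq_uS pr m) (hg κ) hdot hcc]
  push_cast
  rw [inv_inv]

/-- [folklore] **AT THE LIFTED LABEL THE SAME MODEL APPEARS**: `Ã_{N′}(lift N′ m) = ampModel N′ (qlab pr m) pr (φ̃_{N′}) (c̃_{N′}) κ` (`N ≤ N′`). -/
theorem ampT_lift_eq_ampModel (hN : 1 ≤ N) (hNN' : N ≤ N') {pr : Fin D → ℝ} (hq : ∀ i, |pr i| ≤ π) (hq0 : pr ≠ 0) (l : Fin D)
    (m : TorusSite D N) (κ : Fin D) :
    ampT N' pr l (lift N' m) κ = ampModel N' (qlab pr m) pr (phiT N' pr l) (cT N' pr l) κ := by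
  rw [ampT_eq_ampModel (hN.trans hNN') hq hq0, qlab_lift hNN']

end Ident

/-! ## §4 (A-bound) and (A-rate) with the tree's capacitance data -/

section Main

variable {N N' : ℕ} [NeZero N] [NeZero N']

/-- [folklore] **(A-bound) — THE N-UNIFORM BOUND OF THE NORMALISED MINIMISER AMPLITUDE, EVERY ALIAS CLASS**:
`‖Ã_N(m)_κ‖ ≤ WS P · inB ρ (qn pr) (cPP·|q|²) (cPc·|q|²√|q|²)`, `P = qlab pr m`, `ρ = √momSq P`. -/
theorem norm_ampT_le (hN : 1 ≤ N) {pr : Fin D → ℝ} (hq : ∀ i, |pr i| ≤ π) (hq0 : pr ≠ 0) (l : Fin D) (m : TorusSite D N) (κ : Fin D) :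
    ‖ampT N pr l m κ‖ ≤ WS (qlab pr m) * inB (rho (qlab pr m)) (qn pr) (cPP D * momSq pr) (cPc D * (momSq pr * Real.sqrt (momSq pr))) := by
  rw [ampT_eq_ampModel hN hq hq0]
  exact norm_ampModel_le (by omega) (qlab_zone_one hN hq m) (qlab_ne_zero hq hq0 m) (norm_phiT_le hN hq hq0 l) (norm_cT_le hN hq hq0 l) κ

/-- [folklore] **(A-rate) — THE MATCHED-LABEL TWO-LEVEL RATE OF THE NORMALISED MINIMISER AMPLITUDE, EVERY ALIAS CLASS** (`1 ≤ N ≤ N′`):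
`‖Ã_{N′}(lift N′ m)_κ − Ã_N(m)_κ‖ ≤ (6/N)·(Σ_i max 12 |P_i|)·WS P·inB + WS P·inR N ρ qn (cPP|q|²) (cPc|q|³) (crPP|q|⁴/N²) (crPc|q|⁵/N²)`. -/
theorem norm_ampT_lift_sub_le (hN : 1 ≤ N) (hNN' : N ≤ N') {pr : Fin D → ℝ} (hq : ∀ i, |pr i| ≤ π) (hq0 : pr ≠ 0) (l : Fin D)
    (m : TorusSite D N) (κ : Fin D) :
    ‖ampT N' pr l (lift N' m) κ - ampT N pr l m κ‖
      ≤ 6 / N * (∑ i, max 12 |qlab pr m i|) * WS (qlab pr m)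
          * inB (rho (qlab pr m)) (qn pr) (cPP D * momSq pr) (cPc D * (momSq pr * Real.sqrt (momSq pr)))
        + WS (qlab pr m) * inR N (rho (qlab pr m)) (qn pr) (cPP D * momSq pr) (cPc D * (momSq pr * Real.sqrt (momSq pr)))
            (crPP D * momSq pr ^ 2 / (N : ℝ) ^ 2) (crPc D * (momSq pr ^ 2 * Real.sqrt (momSq pr)) / (N : ℝ) ^ 2) := by
  rw [ampT_eq_ampModel hN hq hq0, ampT_lift_eq_ampModel hN hNN' hq hq0]
  exact norm_ampModel_sub_le (by omega) hNN' (qlab_zone_one hN hq m) (qlab_ne_zero hq hq0 m) (norm_phiT_le hN hq hq0 l)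
    (norm_phiT_le (hN.trans hNN') hq hq0 l) (norm_cT_le (hN.trans hNN') hq hq0 l) (norm_phiT_sub_le hN hNN' hq hq0 l)
    (norm_cT_sub_le hN hNN' hq hq0 l) κ

end Main

end Summit.QuantumFields.BalabanUV.Beta.GAN24.FineReadoutCauchyMatched

end
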